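import Mathlib.Analysis.Calculus.LocalExtr.Basic
import Mathlib.Analysis.SpecialFunctions.Sqrt
import Mathlib.Analysis.SpecialFunctions.Trigonometric.Deriv
import Mathlib.MeasureTheory.Function.LocallyIntegrable
import Mathlib.MeasureTheory.Integral.IntervalIntegral.IntegrationByParts
import HarnessLib

/-!
# The weak Wronskian monotonicity (Picone's computation) for `√m` against `sin(ω·)`

Topic `Literature/MathematicalPhysics/QuantumManyBody` (namespace
`Literature.MathematicalPhysics.QuantumManyBody.BoseGas`, sub-namespace `MarginalSturm`). Second
support file for the **marginal Sturm package** (crux `RigidMomentumBound` of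
`AtomisticToContinuum/BoseEinsteinCondensation`, stub `stub_sturmPackage`). Setting: `ω > 0`,
a `C¹` function `m` with continuous derivative `p` (the one-coordinate marginal of a ground state
and its slope), a nonnegative integrable `et` (normal slice kinetic energy) with the Cauchy–Schwarz
relation `p² ≤ 4 m·et` a.e., and the **weak subsolution inequality**
`∫₀^S g·et + ½ ∫₀^S g'·p ≤ ω² ∫₀^S g·m` for every `C¹` test function `g ≥ 0` (what the local virial
identity and the slice energy bound leave after the limit along a minimising sequence). Formally,
for `q = √m` on `{m > 0}`: `q'² = p²/(4m) ≤ et` and `(q q')' ≥ q'² - ω² q²`, i.e. `q'' + ω² q ≥ 0`.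

* `MarginalSturm.integral_deriv_mul_wronskian_nonpos` — on an interval `[a, b] ⊆ [0, min S (π/ω)]`
  where `m > 0`: `∫_a^b g'·W ≤ 0` for every `C¹` `g ≥ 0` vanishing off `(a, b)`, with the Wronskian
  `W = p sin(ω·)/(2√m) - √m·(ω cos(ω·)) = q' sin(ω·) - q (sin(ω·))'`; i.e. `W' ≥ 0` on `(a, b)` in
  the sense of distributions (Sturm's comparison for a weak subsolution). Proof: test the weak
  inequality with Picone's `G = g sin(ω·)/√m`, bound `∫ G·et` below using `et ≥ p²/(4m)`, and
  integrate `∫ g'·√m (sin(ω·))'` by parts; the pointwise identities close by `field_simp`/`ring`.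
* `MarginalSturm.integral_eq_integral_of_forall_not_mem_Ioo` — bookkeeping: `∫₀^S f = ∫_a^b f` for
  `f` vanishing off `(a, b) ⊆ (0, S)`.

Classical (Sturm 1836, Picone 1910) in weak form; tagged folklore. Deliberately NOT here: the
passage from `∫ g' W ≤ 0` to monotonicity of `W` (`MarginalSturmTestMonotone`), the comparison
argument itself (`MarginalSturmComparison`).
-/

noncomputable section

namespace Literature.MathematicalPhysics.QuantumManyBody.BoseGas

open _root_.MeasureTheory _root_.Filter _root_.Set _root_.Real intervalIntegral
open scoped Topology

namespace MarginalSturm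

/-- Interval integrals over `(0, S)` of a function vanishing off `(a, b) ⊆ (0, S)` reduce to
`(a, b)`. [folklore] -/
theorem integral_eq_integral_of_forall_not_mem_Ioo {f : ℝ → ℝ} {S a b : ℝ} (ha : 0 ≤ a)
    (hab : a ≤ b) (hbS : b ≤ S) (hf : ∀ x, x ∉ Ioo a b → f x = 0) :
    ∫ x in (0 : ℝ)..S, f x = ∫ x in a..b, f x := by
  rw [integral_of_le (ha.trans (hab.trans hbS)), integral_of_le hab,
    setIntegral_eq_of_subset_of_forall_sdiff_eq_zero (s := Ioo a b) measurableSet_Ioc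
      (fun x hx => ⟨ha.trans_lt hx.1, hx.2.le.trans hbS⟩) (fun x hx => hf x hx.2),
    setIntegral_eq_of_subset_of_forall_sdiff_eq_zero (s := Ioo a b) measurableSet_Ioc
      Ioo_subset_Ioc_self (fun x hx => hf x hx.2)]

/-- **Weak Wronskian monotonicity (Picone's computation).** Let `ω > 0`, `0 ≤ a < b ≤ min S (π/ω)`,
`p` continuous, `m' = p` everywhere, `m > 0` on `[a, b]`, `et` integrable on `[0, S]` with
`p² ≤ 4 m·et` a.e., and assume the weak subsolution inequality
`∫₀^S g·et + ½ ∫₀^S g'·p ≤ ω² ∫₀^S g·m` for every `C¹` function `g ≥ 0`. Then for every `C¹`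
`g ≥ 0` vanishing off `(a, b)`, `∫_a^b g'·W ≤ 0` for the Wronskian
`W = q' sin(ω·) - q (sin(ω·))'`, `q = √m`, `q' = p/(2√m)`, of `q` with `sin(ω·)`; i.e. `W' ≥ 0`
on `(a, b)` in the sense of distributions. Proof: test the inequality with `G = g sin(ω·)/√m`
(Picone's substitution), use `et ≥ p²/(4m)`, and integrate `∫ g' q (sin(ω·))'` by parts.
[folklore] -/
theorem integral_deriv_mul_wronskian_nonpos {ω S a b : ℝ} {m p et : ℝ → ℝ} (hω : 0 < ω)
    (ha : 0 ≤ a) (hab : a < b) (hbS : b ≤ S) (hbπ : b ≤ π / ω) (hp : Continuous p)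
    (hm : ∀ x, HasDerivAt m (p x) x) (hpos : ∀ x ∈ Icc a b, 0 < m x)
    (het : IntegrableOn et (Icc 0 S))
    (hae : ∀ᵐ x ∂(volume.restrict (Icc 0 S)), 0 ≤ et x ∧ p x ^ 2 ≤ 4 * m x * et x)
    (hineq : ∀ g : ℝ → ℝ, ContDiff ℝ 1 g → (∀ x, 0 ≤ g x) →
      (∫ x in (0 : ℝ)..S, g x * et x) + (1 / 2) * (∫ x in (0 : ℝ)..S, deriv g x * p x) ≤
        ω ^ 2 * ∫ x in (0 : ℝ)..S, g x * m x)
    {g : ℝ → ℝ} (hg : ContDiff ℝ 1 g) (hg0 : ∀ x, 0 ≤ g x) (hga : ∀ x, x ≤ a → g x = 0)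
    (hgb : ∀ x, b ≤ x → g x = 0) :
    ∫ x in a..b, deriv g x *
      (p x * sin (ω * x) / (2 * sqrt (m x)) - sqrt (m x) * (ω * cos (ω * x))) ≤ 0 := by
  have hS0 : 0 ≤ S := ha.trans (hab.le.trans hbS)
  -- derivatives of the comparison function `sin (ω x)`
  have hdφ : ∀ x, HasDerivAt (fun x => sin (ω * x)) (ω * cos (ω * x)) x := fun x => by
    simpa [mul_comm] using ((hasDerivAt_id x).const_mul ω).sin
  have hdφ' : ∀ x, HasDerivAt (fun x => ω * cos (ω * x)) (-(ω ^ 2 * sin (ω * x))) x := fun x => by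
    have h := (((hasDerivAt_id x).const_mul ω).cos).const_mul ω
    simp only [id, mul_one] at h
    exact h.congr_deriv (by ring)
  -- regularity of `m`, `g`
  have hmc : Continuous m := continuous_iff_continuousAt.2 fun x => (hm x).continuousAt
  have hderm : deriv m = p := funext fun x => (hm x).deriv
  have hm1 : ContDiff ℝ 1 m :=
    contDiff_one_iff_deriv.2 ⟨fun x => (hm x).differentiableAt, by rw [hderm]; exact hp⟩
  have hg' : Continuous (deriv g) := hg.continuous_deriv le_rfl
  have hgc : Continuous g := hg.continuous
  have hdg : ∀ x, HasDerivAt g (deriv g x) x := fun x =>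
    ((hg.differentiable one_ne_zero) x).hasDerivAt
  -- `g` and `g'` vanish off `(a, b)`
  have hg_out : ∀ x, x ∉ Ioo a b → g x = 0 := fun x hx => by
    rcases le_or_gt x a with h | h
    · exact hga x h
    · exact hgb x (not_lt.1 fun h' => hx ⟨h, h'⟩)
  have hg'_out : ∀ x, x ∉ Ioo a b → deriv g x = 0 := fun x hx =>
    IsLocalMin.deriv_eq_zero (Filter.Eventually.of_forall fun y => by
      rw [hg_out x hx]; exact hg0 y)
  -- sign of `sin (ω x)` on `[a, b]`, positivity of `√m`
  have hφnn : ∀ x ∈ Icc a b, 0 ≤ sin (ω * x) := fun x hx =>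
    sin_nonneg_of_nonneg_of_le_pi (mul_nonneg hω.le (ha.trans hx.1))
      (by rw [← le_div_iff₀' hω]; exact hx.2.trans hbπ)
  have hq : ∀ x ∈ Icc a b, 0 < sqrt (m x) := fun x hx => sqrt_pos.2 (hpos x hx)
  have hq2 : ∀ x ∈ Icc a b, 2 * sqrt (m x) ≠ 0 := fun x hx =>
    mul_ne_zero two_ne_zero (hq x hx).ne'
  have hq1 : ∀ x ∈ Icc a b, sqrt (m x) ≠ 0 := fun x hx => (hq x hx).ne'
  have hmq : ∀ x ∈ Icc a b, 2 * m x * sqrt (m x) ≠ 0 := fun x hx =>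
    mul_ne_zero (mul_ne_zero two_ne_zero (hpos x hx).ne') (hq x hx).ne'
  have hmq4 : ∀ x ∈ Icc a b, 4 * m x * sqrt (m x) ≠ 0 := fun x hx =>
    mul_ne_zero (mul_ne_zero four_ne_zero (hpos x hx).ne') (hq x hx).ne'
  -- the Picone test function and its derivative
  set G : ℝ → ℝ := fun x => g x * sin (ω * x) / sqrt (m x) with hG
  set G' : ℝ → ℝ := fun x => (deriv g x * sin (ω * x) + g x * (ω * cos (ω * x))) / sqrt (m x) -
    g x * sin (ω * x) * p x / (2 * m x * sqrt (m x)) with hG'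
  have hG_out : ∀ x, x ∉ Ioo a b → G x = 0 := fun x hx => by
    simp only [hG, hg_out x hx, zero_mul, zero_div]
  have hG0 : ∀ x, 0 ≤ G x := fun x => by
    by_cases hx : x ∈ Ioo a b
    · exact div_nonneg (mul_nonneg (hg0 x) (hφnn x (Ioo_subset_Icc_self hx))) (sqrt_nonneg _)
    · rw [hG_out x hx]
  have hG'_out : ∀ x, x ∉ Ioo a b → deriv G x = 0 := fun x hx =>
    IsLocalMin.deriv_eq_zero (Filter.Eventually.of_forall fun y => by
      rw [hG_out x hx]; exact hG0 y)
  have hdG : ∀ x ∈ Icc a b, HasDerivAt G (G' x) x := fun x hx => by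
    have h1 := (((hdg x).mul (hdφ x)).div ((hm x).sqrt (hpos x hx).ne') (hq1 x hx))
    refine h1.congr_deriv ?_
    have hmx : m x = sqrt (m x) ^ 2 := (sq_sqrt (hpos x hx).le).symm
    have hr0 : sqrt (m x) ≠ 0 := hq1 x hx
    simp only [hG', Pi.mul_apply]
    generalize sqrt (m x) = r at hmx hr0 ⊢
    rw [hmx]
    field_simp
  have hGC1 : ContDiff ℝ 1 G := by
    refine contDiff_iff_contDiffAt.2 fun x => ?_
    by_cases hx : 0 < m x
    · exact ((hg.contDiffAt).mul (contDiff_sin.comp (contDiff_const_smul ω) |>.contDiffAt)).div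
        (hm1.contDiffAt.sqrt hx.ne') (sqrt_ne_zero'.2 hx)
    · have hx' : x ∉ Icc a b := fun h => hx (hpos x h)
      have hev : G =ᶠ[𝓝 x] fun _ => 0 := by
        rcases lt_or_ge x a with h | h
        · filter_upwards [Iio_mem_nhds h] with y hy
          exact hG_out y fun hy' => (lt_irrefl _ (hy'.1.trans hy)).elim
        · have h' : b < x := lt_of_not_ge fun h' => hx' ⟨h, h'⟩
          filter_upwards [Ioi_mem_nhds h'] with y hy
          exact hG_out y fun hy' => (lt_irrefl _ (hy.trans hy'.2)).elim
      exact contDiffAt_const.congr_of_eventuallyEq hev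
  -- apply the weak inequality to `G` and restrict all integrals to `(a, b)`
  have key := hineq G hGC1 hG0
  have e1 : ∫ x in (0 : ℝ)..S, G x * et x = ∫ x in a..b, G x * et x :=
    integral_eq_integral_of_forall_not_mem_Ioo ha hab.le hbS fun x hx => by
      rw [hG_out x hx, zero_mul]
  have e2 : ∫ x in (0 : ℝ)..S, deriv G x * p x = ∫ x in a..b, G' x * p x := by
    rw [integral_eq_integral_of_forall_not_mem_Ioo ha hab.le hbS fun x hx => by
      rw [hG'_out x hx, zero_mul]]
    refine integral_congr fun x hx => ?_
    rw [uIcc_of_le hab.le] at hx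
    simp only [(hdG x hx).deriv]
  have e3 : ∫ x in (0 : ℝ)..S, G x * m x = ∫ x in a..b, G x * m x :=
    integral_eq_integral_of_forall_not_mem_Ioo ha hab.le hbS fun x hx => by
      rw [hG_out x hx, zero_mul]
  rw [e1, e2, e3] at key
  -- interval integrability of the continuous integrands on `[a, b]`
  have hci : ∀ f : ℝ → ℝ, ContinuousOn f (Icc a b) → IntervalIntegrable f volume a b :=
    fun f hf => (hf.mono (by rw [uIcc_of_le hab.le])).intervalIntegrable
  have hsin : Continuous fun x => sin (ω * x) := by fun_prop
  have hcos : Continuous fun x => ω * cos (ω * x) := by fun_prop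
  have hsq : Continuous fun x => sqrt (m x) := hmc.sqrt
  -- the a.e. lower bound `G et ≥ g sin(ω·) p² / (4 m √m)`
  have hGet : IntervalIntegrable (fun x => G x * et x) volume a b := by
    rw [intervalIntegrable_iff_integrableOn_Icc_of_le hab.le]
    exact (het.mono_set (Icc_subset_Icc ha hbS)).continuousOn_mul
      hGC1.continuous.continuousOn isCompact_Icc
  have hC_le : ∫ x in a..b, g x * sin (ω * x) * p x ^ 2 / (4 * m x * sqrt (m x)) ≤
      ∫ x in a..b, G x * et x := by
    refine integral_mono_ae_restrict hab.le (hci _ ?_) hGet ?_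
    · fun_prop (disch := assumption)
    · have hae' := ae_restrict_of_ae_restrict_of_subset (Icc_subset_Icc ha hbS) hae
      filter_upwards [hae', ae_restrict_mem measurableSet_Icc] with x hx hxab
      have h1 : p x ^ 2 / (4 * m x) ≤ et x := by
        rw [div_le_iff₀ (by linarith [hpos x hxab])]; linarith [hx.2]
      have h2 : 0 ≤ g x * sin (ω * x) / sqrt (m x) :=
        div_nonneg (mul_nonneg (hg0 x) (hφnn x hxab)) (sqrt_nonneg _)
      have h3 : g x * sin (ω * x) * p x ^ 2 / (4 * m x * sqrt (m x)) =
          g x * sin (ω * x) / sqrt (m x) * (p x ^ 2 / (4 * m x)) := by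
        field_simp
      rw [h3]
      exact mul_le_mul_of_nonneg_left h1 h2
  -- integration by parts with `u = g`, `v = √m (sin(ω·))'`
  have hv : ∀ x ∈ uIcc a b, HasDerivAt (fun x => sqrt (m x) * (ω * cos (ω * x)))
      (p x / (2 * sqrt (m x)) * (ω * cos (ω * x)) + sqrt (m x) * (-(ω ^ 2 * sin (ω * x)))) x :=
    fun x hx => by
      rw [uIcc_of_le hab.le] at hx
      exact ((hm x).sqrt (hpos x hx).ne').mul (hdφ' x)
  have hibp := integral_mul_deriv_eq_deriv_mul (fun x _ => hdg x) hv
    (hg'.intervalIntegrable _ _) (hci _ (by fun_prop (disch := assumption)))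
  rw [hga a le_rfl, hgb b le_rfl, zero_mul, zero_mul, sub_zero, zero_sub] at hibp
  -- assemble
  have hsplitW : ∫ x in a..b, deriv g x *
      (p x * sin (ω * x) / (2 * sqrt (m x)) - sqrt (m x) * (ω * cos (ω * x))) =
      (∫ x in a..b, deriv g x * (p x * sin (ω * x) / (2 * sqrt (m x)))) -
        ∫ x in a..b, deriv g x * (sqrt (m x) * (ω * cos (ω * x))) := by
    rw [← integral_sub (hci _ (by fun_prop (disch := assumption)))
      (hci _ (by fun_prop (disch := assumption)))]
    refine integral_congr fun x _ => ?_
    ring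
  have hcomb : (∫ x in a..b, deriv g x * (p x * sin (ω * x) / (2 * sqrt (m x)))) +
      ∫ x in a..b, g x * (p x / (2 * sqrt (m x)) * (ω * cos (ω * x)) +
        sqrt (m x) * (-(ω ^ 2 * sin (ω * x)))) =
      (∫ x in a..b, g x * sin (ω * x) * p x ^ 2 / (4 * m x * sqrt (m x))) +
        (1 / 2) * (∫ x in a..b, G' x * p x) - ω ^ 2 * ∫ x in a..b, G x * m x := by
    rw [← integral_add (hci _ (by fun_prop (disch := assumption)))
        (hci _ (by fun_prop (disch := assumption))),
      ← intervalIntegral.integral_const_mul, ← intervalIntegral.integral_const_mul,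
      ← integral_add (hci _ (by fun_prop (disch := assumption)))
        (hci _ (by simp only [hG']; fun_prop (disch := assumption))),
      ← integral_sub ((hci _ (by fun_prop (disch := assumption))).add
        (hci _ (by simp only [hG']; fun_prop (disch := assumption))))
        (hci _ (by simp only [hG]; fun_prop (disch := assumption)))]
    refine integral_congr fun x hx => ?_
    rw [uIcc_of_le hab.le] at hx
    have hmx : m x = sqrt (m x) ^ 2 := (sq_sqrt (hpos x hx).le).symm
    have hr0 : sqrt (m x) ≠ 0 := hq1 x hx
    simp only [hG, hG']
    generalize sqrt (m x) = r at hmx hr0 ⊢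
    rw [hmx]
    field_simp
    ring
  have hfin : (∫ x in a..b, deriv g x * (p x * sin (ω * x) / (2 * sqrt (m x)))) -
      (∫ x in a..b, deriv g x * (sqrt (m x) * (ω * cos (ω * x)))) =
      (∫ x in a..b, deriv g x * (p x * sin (ω * x) / (2 * sqrt (m x)))) +
        ∫ x in a..b, g x * (p x / (2 * sqrt (m x)) * (ω * cos (ω * x)) +
          sqrt (m x) * (-(ω ^ 2 * sin (ω * x)))) := by
    rw [hibp]; ring
  rw [hsplitW, hfin, hcomb]
  linarith

end MarginalSturm

end Literature.MathematicalPhysics.QuantumManyBody.BoseGas
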